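import Summits.BirchSwinnertonDyer.BirchSwinnertonDyer.Theorems.AdditiveBranchIMCMultLowerFieldSupplyMAux
import Summits.BirchSwinnertonDyer.BirchSwinnertonDyer.Theorems.AdditiveBranchIMCMultLowerFieldSupplyMSign
import Summits.BirchSwinnertonDyer.BirchSwinnertonDyer.Theorems.AdditiveBranchIMCMultLowerCycLineTwistData
import HarnessLib

/-!
# Route `AdditiveBranchIMC` (rung K1), crux `MultLower` (stmt-BirchSwinnertonDyer-19359), line `tame_roads_mult`
# v4, stub `stub_fieldSupplyM`: FIELD 2, step 1 — the auxiliary rank-one twist on the (M) cell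

Cell `bsd-addord`, seat `bsd-line-addord-w2`. THEOREMS ONLY; no definition, no named fact, no `sorry`.

The (M) twin of `exists_auxTwist` (`…GordTwoRankZeroOffCaseOneFieldSupplyR0Aux`). Data: `E` (`W`, `w(E) = 1`,
additive potentially multiplicative at `p ≥ 5` with multiplicative twist model `C' • V^{(p*)} = W`),
the tame field `K = ℚ(√d_K)` of FIELD 1 (`q* ∣ d_K`, every bad prime `≠ q` split, `2` split), `δ₁ = d_K/q*`.
Choose (`exists_candidateTwist`, Dirichlet) a prime `ℓ₀ ∤ 2pq·N_E·M₀·d_K` with `(ℓ₀*/ℓ) = (p*q*/ℓ)` at the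
odd bad primes `ℓ ∉ {p, q}`, `(ℓ₀*/q) = (p*δ₁/q)`, `p*q*ℓ₀* ≡ 1 (8)`, sign `(−1)^{(ℓ₀−1)/2} = −sgn(p*δ₁)` and
`(ℓ₀*/p) = (δ₁/p)·(−a_p(V))`, so that `T = δ₁ℓ₀*` has `(T/p) = −a_p(V)` and `p*T < 0`. Then every bad prime
`ℓ ≠ p` of `E` splits in `ℚ(√(p*T))`, `gcd(T, N_E) = 1`, and the (M) SIGN LAW
(`rootNumber_mul_rootNumber_ramifiedTwist_of_mult_model`: `w(E)w(E^{(p*T)}) = −(T/p)·(−a_p(V)) = −1`) gives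
`w(X) = −1` for the globally minimal `X ≅ V^{(T)} ≅ E^{(p*T)}`.

References: [Rohrlich1993Compositio] Prop. 2(ii),(iii); [MurtyMurty1997] Ch. 6 §1; [IrelandRosen1990] Ch. 16 §1;
[SilvermanAEC2009] X.5 Cor. 5.4.
-/

set_option linter.dupNamespace false

noncomputable section

open scoped Classical

open WeierstrassCurve NumberField IsDedekindDomain
  Literature.NumberTheory.EllipticCurves
  Literature.NumberTheory.EllipticCurves.ModularForms
  Literature.NumberTheory.EllipticCurves.Rank1Residual
  Literature.NumberTheory.QuadraticFields
  Summit.BirchSwinnertonDyer.Rank1Residual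
  Summit.BirchSwinnertonDyer.Rank1Residual.Additive

namespace Summit.BirchSwinnertonDyer.BirchSwinnertonDyer.Theorems.ThreeFieldRoadSupply

open NumberTheorySymbols
open Summit.BirchSwinnertonDyer.BirchSwinnertonDyer.Theorems.AdditiveKoly.RamifiedHabitat (pStar_emod_four eq_of_prime_dvd_pStar)

section Twist

variable (W : WeierstrassCurve ℚ) [W.IsElliptic] (p : ℕ) [hp : Fact p.Prime]
  {q : ℕ} [hq : Fact q.Prime] (K : Type) [Field K] [NumberField K]
  (V : WeierstrassCurve ℚ) [V.IsElliptic] [V.IsGloballyMinimal]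

omit [V.IsGloballyMinimal] in
/-- **FIELD 2, step 1 on the (M) cell: the auxiliary twist `X ≅ V^{(δ₁ℓ₀*)} ≅ E^{(p*δ₁ℓ₀*)}` of root number
`−1`, with `(δ₁ℓ₀*/p) = −a_p(V)`** (see the module docstring).
[cite: Rohrlich1993Compositio, Prop. 2(ii),(iii)] [cite: IrelandRosen1990, Ch. 16 §1] [cite: SilvermanAEC2009, X.5 Cor. 5.4] -/
theorem exists_auxTwist_mult
    (hmod : exists_isNewformOf) (hp5 : 5 ≤ p) (hw : W.rootNumber = 1) (hadd : Addv W p)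
    (hqp : q ≠ p) (hq2 : q ≠ 2) (hqm : W.HasMultiplicativeReductionAtPrime q)
    (hK : IsImaginaryQuadratic K) (h2K : ((Ideal.span {(2 : ℤ)}).primesOver (𝓞 K)).ncard = 2)
    (hqd : (q : ℤ) ∣ NumberField.discr K)
    (hsplit : ∀ ℓ : ℕ, ℓ.Prime → ℓ ∣ W.conductorNorm ℤ → ℓ ≠ q →
      ((Ideal.span {(ℓ : ℤ)}).primesOver (𝓞 K)).ncard = 2)
    (C' : VariableChange ℚ) (hC' : C' • V.quadraticTwist ((-1 : ℚ) ^ (p / 2) * p) = W)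
    (hmultV : V.HasMultiplicativeReductionAtPrime p) (M₀ : ℕ) (hM₀ : M₀ ≠ 0) :
    ∃ (δ : ℤ) (ℓ₀ : ℕ) (X : WeierstrassCurve ℚ) (_ : X.IsElliptic) (_ : X.IsGloballyMinimal)
      (CX : VariableChange ℚ),
      NumberField.discr K = ((-1 : ℤ) ^ (q / 2) * q) * δ ∧ Squarefree δ ∧ ¬ (p : ℤ) ∣ δ ∧
      ℓ₀.Prime ∧ ℓ₀ ≠ p ∧ ℓ₀ ≠ q ∧ ¬ ℓ₀ ∣ W.conductorNorm ℤ * M₀ ∧ ¬ (ℓ₀ : ℤ) ∣ δ ∧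
      (((-1 : ℤ) ^ (p / 2) * p) * ((-1 : ℤ) ^ (q / 2) * q) * ((-1 : ℤ) ^ (ℓ₀ / 2) * ℓ₀)) % 8 = 1 ∧
      (∀ ℓ : ℕ, ℓ.Prime → ℓ ∣ W.conductorNorm ℤ * M₀ → ℓ ≠ 2 → ℓ ≠ p → ℓ ≠ q →
        J((-1 : ℤ) ^ (ℓ₀ / 2) * ℓ₀ | ℓ) = J(((-1 : ℤ) ^ (p / 2) * p) * ((-1 : ℤ) ^ (q / 2) * q) | ℓ)) ∧
      J((-1 : ℤ) ^ (ℓ₀ / 2) * ℓ₀ | q) = J(((-1 : ℤ) ^ (p / 2) * p) * δ | q) ∧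
      (J(δ * ((-1 : ℤ) ^ (ℓ₀ / 2) * ℓ₀) | p) =
        if V.HasSplitMultiplicativeReductionAtPrime p then -1 else 1) ∧
      (δ * ((-1 : ℤ) ^ (ℓ₀ / 2) * ℓ₀)) % 4 = 1 ∧
      ((-1 : ℤ) ^ (p / 2) * p) * (δ * ((-1 : ℤ) ^ (ℓ₀ / 2) * ℓ₀)) < 0 ∧
      (∀ ℓ : ℕ, ℓ.Prime → ℓ ∣ W.conductorNorm ℤ → ℓ ≠ p → ℓ ≠ 2 →
        J(((-1 : ℤ) ^ (p / 2) * p) * (δ * ((-1 : ℤ) ^ (ℓ₀ / 2) * ℓ₀)) | ℓ) = 1) ∧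
      (2 ∣ W.conductorNorm ℤ → (((-1 : ℤ) ^ (p / 2) * p) * (δ * ((-1 : ℤ) ^ (ℓ₀ / 2) * ℓ₀))) % 8 = 1) ∧
      CX • X = V.quadraticTwist ((δ * ((-1 : ℤ) ^ (ℓ₀ / 2) * ℓ₀) : ℤ) : ℚ) ∧ X.rootNumber = -1 := by
  have hp2 : p ≠ 2 := by omega
  have hpq : p ≠ q := fun h ↦ hqp h.symm
  -- notation
  set ps : ℤ := (-1 : ℤ) ^ (p / 2) * p with hps
  set qs : ℤ := (-1 : ℤ) ^ (q / 2) * q with hqs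
  have hdK0 : NumberField.discr K ≠ 0 := NumberField.discr_ne_zero K
  obtain ⟨hdK8, -, -, -⟩ := discr_emod_eight_of_two_split K hK h2K
  -- the bad primes
  have hpN : p ∣ W.conductorNorm ℤ :=
    (W.dvd_conductorNorm_iff_not_hasGoodReductionAtPrime p).mpr hadd.1
  have hqN : q ∣ W.conductorNorm ℤ :=
    (W.dvd_conductorNorm_iff_not_hasGoodReductionAtPrime q).mpr
      (not_hasGoodReductionAtPrime_of_hasMultiplicativeReductionAtPrime q hqm)
  have hNW0 : W.conductorNorm ℤ ≠ 0 := (W.conductorNorm_pos_holds).ne'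
  have hNVW : ∀ ℓ : ℕ, ℓ.Prime → ℓ ∣ V.conductorNorm ℤ → ℓ ∣ W.conductorNorm ℤ := fun ℓ hℓ hℓV ↦
    AdditiveBranchIMCMultLower.dvd_conductorNorm_of_dvd_conductorNorm_twist_model hp2 V W C' hC' hadd hℓ hℓV
  -- §b the genus factor `δ₁`
  obtain ⟨hfac, hδ4, hδsq, hqδ, hpδ, hδgood⟩ :=
    genusFactor_spec (p := p) (q := q) W K hK h2K hq2 hqd hsplit hpN hpq
  set δ : ℤ := NumberField.discr K / qs with hδ
  clear_value δ
  have hδ0 : δ ≠ 0 := by rintro h; rw [h, mul_zero] at hfac; exact hdK0 hfac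
  have hps0 : ps ≠ 0 := by
    rw [hps]; exact mul_ne_zero (pow_ne_zero _ (by norm_num)) (by exact_mod_cast hp.out.ne_zero)
  have hpsδ0 : ps * δ ≠ 0 := mul_ne_zero hps0 hδ0
  -- §c the choices: sign `σ = −sgn(p*δ₁)`, class `(ℓ₀*/p) = (δ₁/p)·(−a_p(V))`
  set σ : ℤ := - Int.sign (ps * δ) with hσ
  have hσ1 : σ = 1 ∨ σ = -1 := by
    rcases lt_trichotomy (ps * δ) 0 with h | h | h
    · left; rw [hσ, Int.sign_eq_neg_one_of_neg h]; norm_num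
    · exact (hpsδ0 h).elim
    · right; rw [hσ, Int.sign_eq_one_of_pos h]
  set a : ℤ := (if V.HasSplitMultiplicativeReductionAtPrime p then -1 else 1) with ha
  have ha1 : a = 1 ∨ a = -1 := by rw [ha]; split_ifs <;> simp
  have hJδp : J(δ | p) = 1 ∨ J(δ | p) = -1 := by
    rcases jacobiSym.trichotomy δ p with h0 | h0 | h0
    · exfalso
      have := jacobiSym_mul_self_eq_one hp.out hpδ
      rw [h0, mul_zero] at this
      exact zero_ne_one this
    · exact Or.inl h0
    · exact Or.inr h0
  set εp : ℤ := J(δ | p) * a with hεp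
  have hεp1 : εp = 1 ∨ εp = -1 := by
    rcases hJδp with h | h <;> rcases ha1 with h' | h' <;> simp [hεp, h, h']
  obtain ⟨ℓ₀, X, iX, iXm, CX, hℓ₀, hℓ₀2, hℓ₀p, hℓ₀q, hℓ₀M, hℓ₀δ, hσℓ₀, h8ℓ₀, hJsplit, hJq, hJp, hT4, hTsq,
      hCX, -⟩ :=
    exists_candidateTwist W p K V hmod hp2 hqp hq2 hK h2K hqd hsplit hfac hδsq hqδ hpδ hδgood hNVW hpN
      hqN M₀ hM₀ hσ1 hεp1
  set ls : ℤ := (-1 : ℤ) ^ (ℓ₀ / 2) * ℓ₀ with hls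
  set T : ℤ := δ * ls with hT
  have hℓ₀NW : ¬ ℓ₀ ∣ W.conductorNorm ℤ := fun h ↦ hℓ₀M (h.mul_right _)
  have hT0 : T ≠ 0 := by rintro h; rw [h] at hT4; norm_num at hT4
  have hTq : (T : ℚ) ≠ 0 := by exact_mod_cast hT0
  have hps4 : ps % 4 = 1 := pStar_emod_four (p := p) hp2
  have hpsq : ¬ (q : ℤ) ∣ ps * δ := by
    intro h
    rcases Int.Prime.dvd_mul' hq.out h with h | h
    · exact hqp (eq_of_prime_dvd_pStar (p := p) hq.out h)
    · exact hqδ h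
  -- `(T/p) = a`
  have hJTp : J(T | p) = a := by
    rw [hT, jacobiSym.mul_left, hJp, hεp, ← mul_assoc, jacobiSym_mul_self_eq_one hp.out hpδ, one_mul]
  -- `p* T < 0`
  have hpsT : ps * T = (ps * δ) * ls := by rw [hT]; ring
  have hneg : ps * T < 0 := by
    rw [hpsT, hls, hσℓ₀, hσ]
    have habs : (ps * δ) * Int.sign (ps * δ) = ((ps * δ).natAbs : ℤ) := Int.mul_sign_self (ps * δ)
    have hpos : (0 : ℤ) < (ps * δ).natAbs := by exact_mod_cast Int.natAbs_pos.mpr hpsδ0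
    have hℓ₀pos : (0 : ℤ) < ℓ₀ := by exact_mod_cast hℓ₀.pos
    nlinarith [habs, hpos, hℓ₀pos]
  -- every bad prime `ℓ ≠ p` of `E` splits in `ℚ(√(p* T))`
  have hb : ∀ ℓ : ℕ, ℓ.Prime → ℓ ∣ W.conductorNorm ℤ → ℓ ≠ p → ℓ ≠ 2 → J(ps * T | ℓ) = 1 := by
    intro ℓ hℓ hℓW hℓp hℓ2
    by_cases hℓq : ℓ = q
    · subst hℓq
      rw [hpsT, jacobiSym.mul_left, hJq]
      exact jacobiSym_mul_self_eq_one hq.out hpsq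
    · have hJ' : J(ls | ℓ) = J(ps * qs | ℓ) := hJsplit ℓ hℓ (hℓW.mul_right _) hℓ2 hℓp hℓq
      have hdKℓ : J(NumberField.discr K | ℓ) = 1 :=
        (Quadratic.ncard_primesOver_eq_two_iff_jacobiSym hK.1 hℓ hℓ2).mp (hsplit ℓ hℓ hℓW hℓq)
      have hpsℓ : ¬ (ℓ : ℤ) ∣ ps := fun hd ↦ hℓp (eq_of_prime_dvd_pStar (p := p) hℓ hd)
      have e1 : J(ps * T | ℓ) = J(ps * δ | ℓ) * J(ls | ℓ) := by
        rw [hpsT]; exact jacobiSym.mul_left _ _ _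
      have e2 : J(ps * δ | ℓ) = J(ps | ℓ) * J(δ | ℓ) := jacobiSym.mul_left _ _ _
      have e3 : J(ps * qs | ℓ) = J(ps | ℓ) * J(qs | ℓ) := jacobiSym.mul_left _ _ _
      have e4 : J(qs * δ | ℓ) = J(qs | ℓ) * J(δ | ℓ) := jacobiSym.mul_left _ _ _
      have hsq := jacobiSym_mul_self_eq_one hℓ hpsℓ
      have hqδ1 : J(qs | ℓ) * J(δ | ℓ) = 1 := by rw [← e4, ← hfac, hdKℓ]
      rw [e1, hJ', e2, e3]
      calc J(ps | ℓ) * J(δ | ℓ) * (J(ps | ℓ) * J(qs | ℓ))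
          = (J(ps | ℓ) * J(ps | ℓ)) * (J(qs | ℓ) * J(δ | ℓ)) := by ring
        _ = 1 := by rw [hsq, hqδ1, one_mul]
  have h8 : 2 ∣ W.conductorNorm ℤ → (ps * T) % 8 = 1 := by
    intro _
    -- `ps T qs² = (ps qs ls)(qs δ) ≡ 1` and `qs² ≡ 1 (mod 8)`
    have e : ps * T * (qs * qs) = (ps * qs * ls) * (qs * δ) := by rw [hT]; ring
    have h1' : (ps * T * (qs * qs)) % 8 = 1 := by
      rw [e, Int.mul_emod, h8ℓ₀, ← hfac, hdK8]; decide
    have hqs4 : qs % 4 = 1 := pStar_emod_four (p := q) hq2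
    have hqs2 : (qs * qs) % 8 = 1 := Int.mul_self_emod_eight_of_odd (by omega)
    have h2' : (ps * T * (qs * qs)) % 8 = ((ps * T) % 8 * ((qs * qs) % 8)) % 8 := Int.mul_emod _ _ _
    rw [hqs2, mul_one, Int.emod_emod_of_dvd _ (dvd_refl (8 : ℤ))] at h2'
    rw [← h2', h1']
  -- `gcd(T, N_E) = 1`
  have hgcd : Int.gcd T (W.conductorNorm ℤ) = 1 := by
    rw [Int.gcd_eq_natAbs, Int.natAbs_natCast]
    refine Nat.coprime_of_dvd fun ℓ hℓ hℓT hℓN ↦ ?_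
    have hℓT' : (ℓ : ℤ) ∣ T := by
      have := Int.natAbs_dvd_natAbs.mp (by simpa using hℓT : (ℓ : ℤ).natAbs ∣ T.natAbs); exact this
    rw [hT] at hℓT'
    rcases Int.Prime.dvd_mul' hℓ hℓT' with h | h
    · exact hδgood ℓ hℓ h hℓN
    · have h' : ℓ ∣ ls.natAbs := by simpa using Int.natAbs_dvd_natAbs.mpr h
      rw [hls, natAbs_pStar] at h'
      rw [(Nat.prime_dvd_prime_iff_eq hℓ hℓ₀).mp h'] at hℓN
      exact hℓ₀NW hℓN
  -- §d the sign: `w(E)·w(E^{(p*T)}) = −(T/p)·a = −1`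
  have hsign := rootNumber_mul_rootNumber_ramifiedTwist_of_mult_model W p hmod hp5 hadd V C' hC' hmultV
    hT4 hTsq hgcd hneg hb h8
  rw [← ha, jacobiSym.legendreSym.to_jacobiSym, hJTp, hw, one_mul] at hsign
  have ha2 : -a * a = -1 := by rcases ha1 with h | h <;> rw [h] <;> norm_num
  rw [ha2] at hsign
  -- `E^{(p*T)} ≅ V^{(p*² T)} ≅ V^{(T)} ≅ X`
  haveI := V.isElliptic_quadraticTwist hTq
  have hXW : ∃ C : VariableChange ℚ, W.quadraticTwist (((ps * T : ℤ)) : ℚ) = C • X := by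
    obtain ⟨C'', hC''⟩ : ∃ C'' : VariableChange ℚ, C'' = ⟨C'.u, (((ps * T : ℤ)) : ℚ) * C'.r, 0, 0⟩ :=
      ⟨_, rfl⟩
    have hparam : ((-1 : ℚ) ^ (p / 2) * (p : ℚ)) * (((ps * T : ℤ)) : ℚ) =
        ((T : ℤ) : ℚ) * ((ps : ℤ) : ℚ) ^ 2 := by
      rw [hps]; push_cast; ring
    have e1 : W.quadraticTwist (((ps * T : ℤ)) : ℚ) =
        C'' • V.quadraticTwist (((T : ℤ) : ℚ) * ((ps : ℤ) : ℚ) ^ 2) := by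
      rw [← hC', WeierstrassCurve.quadraticTwist_smul, quadraticTwist_quadraticTwist, ← hC'', hparam]
    have hps0' : ((ps : ℤ) : ℚ) ≠ 0 := by exact_mod_cast hps0
    obtain ⟨C₂, hC₂⟩ := V.exists_variableChange_quadraticTwist_mul_sq ((T : ℤ) : ℚ) _ hps0'
    refine ⟨C'' * C₂ * CX, ?_⟩
    rw [e1, ← hC₂, ← hCX, mul_smul, mul_smul]
  have hXroot : X.rootNumber = -1 := by
    obtain ⟨C, hC⟩ := hXW
    rw [hC, X.rootNumber_smul_holds C] at hsign
    exact hsign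
  exact ⟨δ, ℓ₀, X, iX, iXm, CX, hfac, hδsq, hpδ, hℓ₀, hℓ₀p, hℓ₀q, hℓ₀M, hℓ₀δ, h8ℓ₀, hJsplit, hJq, hJTp,
    hT4, hneg, hb, h8, hCX, hXroot⟩

end Twist

end Summit.BirchSwinnertonDyer.BirchSwinnertonDyer.Theorems.ThreeFieldRoadSupply

end
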